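import Mathlib
import Summits.Ventures.PercRepro2.GradedSP2

/-!
# The graded Hall families G_k and V2_k hold on every series–parallel network, at every level
(seat mine-b, cell pub-perc-repro2; conjectures/MINE-B.md §20.13–20.17 and §21)

GradedClosure.lean gives the series closures of `G_k` and `V2_k` and the parallel closure of `G_k`;
GradedSP2.lean the parallel closure of `V2_2`.  The missing step was the parallel closure of `V2_k`
for `k ≥ 3`.  It is proved here by a RELAY certificate: on the sum product a source `(x, y)` (both red
labels `0`, blue labels `α + β ≥ k`) whose `y`-side already carries `β ≥ k − 1` blue has no target in
its own fibre; its `α` slots are relayed through `V2_2` of the fibre over `y` (to `x' ≤ x` at blue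
level `1`, red `≥ 1`) and then through `V2_{k−1}` of the fibre over `x'` (to `y' ≤ y` at blue level
`k − 2`, red `≥ 1`), so that `(x', y')` is a genuine target at blue level `k − 1`; the multiplier of
`V2_2` on the fibre over `y` is the blue label `β` itself (the relay pays `α·β ≥ α`), which is why no
certificate with bounded multipliers exists.  The single slot of a source with `α = 1` goes through
the level-1 Harris inequality of the fibre over `y` (to `x'` at blue level `0`) and, if `β ≥ k`,
through `V2_k` of the fibre over `x'`.  In formulas (`psiVk`, everything doubled for integrality): a
fibre with labels `(ρ, β)` charges

  `2·v_{k−β}`  if `ρ = 0, β ≤ k − 2`;   `β·v_2 + 2·h_1`  if `ρ = 0, β ≥ k − 1`;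
  `2·v_k`  if `ρ ≥ 1, β = 0`;   `v_{k−1}`  if `ρ ≥ 1, β = 1`;   `0` otherwise,

and `pointwiseVpar` shows `Ψ(y; x) + Ψ(x; y) ≤ 2·v_k(x ∗ y)` for all labels.  Hence `vDom_par`:
`V2_j` for `2 ≤ j ≤ k` and the level Harris inequalities on the parts give `V2_k` on the parallel
product.  With the atoms and the induction over `SP` (carrying `DownDom`, `LevelHarris` and the
whole family) this yields

  `SP.gDom : ∀ k (s : SP), GDom k s.rLab s.bLab`  and  `SP.vDom : ∀ k, 2 ≤ k → ∀ s : SP, VDom k s.rLab s.bLab`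

— on every series–parallel network and at every level `k ≥ 2`, every lower set `D` of the
configuration poset has `#(D ∩ {r = 1, b ≥ k−1}) ≥ Σ_{D ∩ {r = 0, b ≥ k}} b` (so by Hall every
configuration with `F_R = 0`, `F_B = a ≥ k` owns `a` private configurations below it with `F_R = 1`
and `F_B ≥ k − 1`) and `#(D ∩ {b = k−1, r ≥ 1}) ≥ Σ_{D ∩ {r = 0, b ≥ k}} b`.
-/

namespace Summit.Ventures.PercRepro2.UHClosure

open Finset

variable {X Y : Type*}

/-- twice the relay certificate: the charge of a fibre with labels `(ρ, β)` at a point with labels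
`(a, c)`, for the target `V2_k` on the parallel product -/
def psiVk (k ρ β a c : ℕ) : ℤ :=
  if ρ = 0 then (if β + 2 ≤ k then 2 * vw (k - β) a c else (β : ℤ) * vw 2 a c + 2 * hw1 a c)
  else (if β = 0 then 2 * vw k a c else if β = 1 then vw (k - 1) a c else 0)

/-- the charge of a fibre at red level 0 -/
lemma psiVk_zero (k β a c : ℕ) :
    psiVk k 0 β a c = if β + 2 ≤ k then 2 * vw (k - β) a c else (β : ℤ) * vw 2 a c + 2 * hw1 a c := by
  unfold psiVk; simp

/-- the charge of a fibre at red level ≥ 1 -/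
lemma psiVk_pos (k ρ β a c : ℕ) (h : 1 ≤ ρ) :
    psiVk k ρ β a c = if β = 0 then 2 * vw k a c else if β = 1 then vw (k - 1) a c else 0 := by
  unfold psiVk; simp [show ρ ≠ 0 by omega]

/-- the level-1 Harris weight at red level 0 -/
lemma hw1_zero (c : ℕ) : hw1 0 c = -(if 1 ≤ c then 1 else 0) := by unfold hw1; simp

/-- the level-1 Harris weight at red level ≥ 1 -/
lemma hw1_pos (a c : ℕ) (h : 1 ≤ a) : hw1 a c = 1 - (if 1 ≤ c then 1 else 0) := by unfold hw1; simp [h]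

section cases
variable (k : ℕ) (hk : 3 ≤ k)
include hk

/-- the relay certificate, both red levels 0 -/
lemma prv_00 (c β : ℕ) : psiVk k 0 β 0 c + psiVk k 0 c 0 β ≤ 2 * vw k (0 + 0) (c + β) := by
  simp only [psiVk_zero, vw_zero, hw1_zero, Nat.add_zero]
  have hc0 : (0 : ℤ) ≤ c := by positivity
  have hb0 : (0 : ℤ) ≤ β := by positivity
  split_ifs <;> push_cast <;> first | omega | nlinarith

/-- the relay certificate, red levels 0 and ≥ 1 -/
lemma prv_0p (c ρ β : ℕ) (hρ : 1 ≤ ρ) : psiVk k ρ β 0 c + psiVk k 0 c ρ β ≤ 2 * vw k (0 + ρ) (c + β) := by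
  simp only [psiVk_zero, psiVk_pos _ _ _ _ _ hρ, vw_zero, vw_pos _ _ _ hρ, hw1_pos _ _ hρ, Nat.zero_add]
  split_ifs <;> push_cast <;> omega

/-- the relay certificate, both red levels ≥ 1 -/
lemma prv_pp (a c ρ β : ℕ) (ha : 1 ≤ a) (hρ : 1 ≤ ρ) :
    psiVk k ρ β a c + psiVk k a c ρ β ≤ 2 * vw k (a + ρ) (c + β) := by
  simp only [psiVk_pos _ _ _ _ _ hρ, psiVk_pos _ _ _ _ _ ha, vw_pos _ _ _ hρ, vw_pos _ _ _ ha]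
  have : vw k (a + ρ) (c + β) = if c + β = k - 1 then 1 else 0 := vw_pos _ _ _ (by omega)
  rw [this]
  split_ifs <;> omega

end cases

/-- the charges commute -/
lemma psiVk_comm (k ρ β a c : ℕ) : psiVk k ρ β a c + psiVk k a c ρ β = psiVk k a c ρ β + psiVk k ρ β a c :=
  add_comm _ _

/-- **The pointwise relay certificate for the parallel closure of `V2_k`, `k ≥ 3`.** -/
theorem pointwiseVpar (k a c ρ β : ℕ) (hk : 3 ≤ k) :
    psiVk k ρ β a c + psiVk k a c ρ β ≤ 2 * vw k (a + ρ) (c + β) := by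
  rcases Nat.eq_zero_or_pos a with ha | ha <;> rcases Nat.eq_zero_or_pos ρ with hρ | hρ
  · subst ha; subst hρ; exact prv_00 k hk c β
  · subst ha; exact prv_0p k hk c ρ β hρ
  · subst hρ; rw [psiVk_comm, Nat.add_comm a 0, Nat.add_comm c β]; exact prv_0p k hk β a c ha
  · exact prv_pp k hk a c ρ β ha hρ

section fibres

variable [Preorder X] [Preorder Y] [Fintype X] [Fintype Y] [DecidableEq X] [DecidableEq Y]

omit [Fintype Y] in
/-- the relay charge of the fibre over `y` is non-negative, from `V2_j` (`2 ≤ j ≤ k`) and the level-1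
Harris inequality of `X` -/
theorem fibre_psiVk_fst (k : ℕ) (hk : 3 ≤ k) (r b : X → ℕ) (hV : ∀ j, 2 ≤ j → j ≤ k → VDom j r b)
    (hH : LevelHarris r b) (D : Finset (X × Y)) (hD : IsLowerSet (↑D : Set (X × Y))) (ρ β : ℕ) (y : Y) :
    0 ≤ ∑ x, ind D x y * psiVk k ρ β (r x) (b x) := by
  unfold psiVk
  split_ifs with h1 h2 h3 h4
  · have e : ∑ x, ind D x y * (2 * vw (k - β) (r x) (b x)) = 2 * ∑ x, ind D x y * vw (k - β) (r x) (b x) := by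
      rw [Finset.mul_sum]; apply Finset.sum_congr rfl; intro x _; ring
    rw [e]
    exact mul_nonneg (by norm_num) (fibre_fst_of_lower _ (hV (k - β) (by omega) (Nat.sub_le k β)) D hD y)
  · have e : ∑ x, ind D x y * ((β : ℤ) * vw 2 (r x) (b x) + 2 * hw1 (r x) (b x))
        = (β : ℤ) * ∑ x, ind D x y * vw 2 (r x) (b x) + 2 * ∑ x, ind D x y * hw1 (r x) (b x) := by
      rw [Finset.mul_sum, Finset.mul_sum, ← Finset.sum_add_distrib]
      apply Finset.sum_congr rfl; intro x _; ring
    rw [e]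
    exact add_nonneg (mul_nonneg (by positivity) (fibre_fst_of_lower _ (hV 2 le_rfl (by omega)) D hD y))
      (mul_nonneg (by norm_num) (fibre_hw1_fst r b hH D hD y))
  · have e : ∑ x, ind D x y * (2 * vw k (r x) (b x)) = 2 * ∑ x, ind D x y * vw k (r x) (b x) := by
      rw [Finset.mul_sum]; apply Finset.sum_congr rfl; intro x _; ring
    rw [e]
    exact mul_nonneg (by norm_num) (fibre_fst_of_lower _ (hV k (by omega) le_rfl) D hD y)
  · exact fibre_fst_of_lower _ (hV (k - 1) (by omega) (Nat.sub_le k 1)) D hD y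
  · simp

omit [Fintype X] in
/-- the relay charge of the fibre over `x` is non-negative, from `V2_j` (`2 ≤ j ≤ k`) and the level-1
Harris inequality of `Y` -/
theorem fibre_psiVk_snd (k : ℕ) (hk : 3 ≤ k) (r' b' : Y → ℕ) (hV : ∀ j, 2 ≤ j → j ≤ k → VDom j r' b')
    (hH : LevelHarris r' b') (D : Finset (X × Y)) (hD : IsLowerSet (↑D : Set (X × Y))) (ρ β : ℕ) (x : X) :
    0 ≤ ∑ y, ind D x y * psiVk k ρ β (r' y) (b' y) := by
  unfold psiVk
  split_ifs with h1 h2 h3 h4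
  · have e : ∑ y, ind D x y * (2 * vw (k - β) (r' y) (b' y)) = 2 * ∑ y, ind D x y * vw (k - β) (r' y) (b' y) := by
      rw [Finset.mul_sum]; apply Finset.sum_congr rfl; intro y _; ring
    rw [e]
    exact mul_nonneg (by norm_num) (fibre_snd_of_lower _ (hV (k - β) (by omega) (Nat.sub_le k β)) D hD x)
  · have e : ∑ y, ind D x y * ((β : ℤ) * vw 2 (r' y) (b' y) + 2 * hw1 (r' y) (b' y))
        = (β : ℤ) * ∑ y, ind D x y * vw 2 (r' y) (b' y) + 2 * ∑ y, ind D x y * hw1 (r' y) (b' y) := by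
      rw [Finset.mul_sum, Finset.mul_sum, ← Finset.sum_add_distrib]
      apply Finset.sum_congr rfl; intro y _; ring
    rw [e]
    exact add_nonneg (mul_nonneg (by positivity) (fibre_snd_of_lower _ (hV 2 le_rfl (by omega)) D hD x))
      (mul_nonneg (by norm_num) (fibre_hw1_snd r' b' hH D hD x))
  · have e : ∑ y, ind D x y * (2 * vw k (r' y) (b' y)) = 2 * ∑ y, ind D x y * vw k (r' y) (b' y) := by
      rw [Finset.mul_sum]; apply Finset.sum_congr rfl; intro y _; ring
    rw [e]
    exact mul_nonneg (by norm_num) (fibre_snd_of_lower _ (hV k (by omega) le_rfl) D hD x)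
  · exact fibre_snd_of_lower _ (hV (k - 1) (by omega) (Nat.sub_le k 1)) D hD x
  · simp

/-- **`V2_k` (`k ≥ 3`) is closed under parallel composition, given `V2_j` for `2 ≤ j ≤ k` and the level
Harris inequalities on the parts** (the relay certificate). -/
theorem vDom_par (k : ℕ) (hk : 3 ≤ k) (r b : X → ℕ) (r' b' : Y → ℕ)
    (hV : ∀ j, 2 ≤ j → j ≤ k → VDom j r b) (hH : LevelHarris r b)
    (hV' : ∀ j, 2 ≤ j → j ≤ k → VDom j r' b') (hH' : LevelHarris r' b') :
    VDom k (fun p : X × Y => r p.1 + r' p.2) (fun p : X × Y => b p.1 + b' p.2) := by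
  intro D hD
  have key : ∀ p ∈ D, psiVk k (r' p.2) (b' p.2) (r p.1) (b p.1) + psiVk k (r p.1) (b p.1) (r' p.2) (b' p.2)
      ≤ 2 * vw k (r p.1 + r' p.2) (b p.1 + b' p.2) := by
    intro p _; obtain ⟨x, y⟩ := p; exact pointwiseVpar k _ _ _ _ hk
  have hsum := Finset.sum_le_sum key
  rw [Finset.sum_add_distrib, ← Finset.mul_sum] at hsum
  have h1 : 0 ≤ ∑ p ∈ D, psiVk k (r' p.2) (b' p.2) (r p.1) (b p.1) := by
    rw [sum_D_eq' D (fun x y => psiVk k (r' y) (b' y) (r x) (b x)), Finset.sum_comm]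
    exact Finset.sum_nonneg (fun y _ => fibre_psiVk_fst k hk r b hV hH D hD (r' y) (b' y) y)
  have h2 : 0 ≤ ∑ p ∈ D, psiVk k (r p.1) (b p.1) (r' p.2) (b' p.2) := by
    rw [sum_D_eq' D (fun x y => psiVk k (r x) (b x) (r' y) (b' y))]
    exact Finset.sum_nonneg (fun x _ => fibre_psiVk_snd k hk r' b' hV' hH' D hD (r x) (b x) x)
  linarith

end fibres

end Summit.Ventures.PercRepro2.UHClosure

namespace Summit.Ventures.PercRepro2.V2Closure

open Finset
open Summit.Ventures.PercRepro2.UHClosure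

/-- on a free edge every weight of `G_j`, `j ≥ 2`, vanishes (no blue level ≥ 2, no red level 1 with blue ≥ 1) -/
theorem free_gDom (j : ℕ) (hj : 2 ≤ j) : GDom j SP.free.rLab SP.free.bLab := by
  intro V _
  apply Finset.sum_nonneg; intro c _
  cases c <;> (unfold gw; simp [SP.rLab, SP.bLab]; omega)
/-- on a free edge every weight of `V2_j`, `j ≥ 2`, vanishes -/
theorem free_vDom (j : ℕ) (hj : 2 ≤ j) : VDom j SP.free.rLab SP.free.bLab := by
  intro V _
  apply Finset.sum_nonneg; intro c _
  cases c <;> (unfold vw; simp [SP.rLab, SP.bLab]; omega)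
/-- on a pinned edge the single state has non-negative `G_j`-weight -/
theorem pin_gDom (j : ℕ) : GDom j SP.pin.rLab SP.pin.bLab := by
  intro V _
  apply Finset.sum_nonneg; intro c _
  unfold gw; simp [SP.rLab, SP.bLab]; split_ifs <;> norm_num
/-- on a pinned edge the single state has non-negative `V2_j`-weight -/
theorem pin_vDom (j : ℕ) : VDom j SP.pin.rLab SP.pin.bLab := by
  intro V _
  apply Finset.sum_nonneg; intro c _
  unfold vw; simp [SP.rLab, SP.bLab]; split_ifs <;> norm_num
/-- on an absent edge the `G_j`-weights vanish -/
theorem absent_gDom (j : ℕ) : GDom j SP.absent.rLab SP.absent.bLab := by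
  intro V _
  apply Finset.sum_nonneg; intro c _
  unfold gw; simp [SP.rLab, SP.bLab]
/-- on an absent edge the `V2_j`-weights vanish -/
theorem absent_vDom (j : ℕ) : VDom j SP.absent.rLab SP.absent.bLab := by
  intro V _
  apply Finset.sum_nonneg; intro c _
  unfold vw; simp [SP.rLab, SP.bLab]

/-- all levels of the `G` family below `k` from `DownDom` and the levels `≥ 2` -/
theorem gDom_le_of {X : Type*} [Preorder X] (r b : X → ℕ) (h1 : DownDom r b)
    (h2 : ∀ j, 2 ≤ j → GDom j r b) : ∀ k, ∀ j, j ≤ k → GDom j r b := by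
  intro k j _
  rcases Nat.lt_or_ge j 2 with h | h
  · exact gDom_of_downDom j (by omega) r b h1
  · exact h2 j h

/-- **(UH), the level Harris inequalities and the whole graded family `{G_j, V2_j : j ≥ 2}` hold on
every series–parallel network** (induction over the network with `downDom_ser` / `downDom_par`,
`levelHarris_ser` / `levelHarris_par`, `gDom_ser` / `gDom_par_le`, `vDom_ser` / `vDom_par2` / `vDom_par`). -/
theorem SP.graded : ∀ s : SP, DownDom s.rLab s.bLab ∧ LevelHarris s.rLab s.bLab ∧
    ∀ j, 2 ≤ j → GDom j s.rLab s.bLab ∧ VDom j s.rLab s.bLab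
  | .free => ⟨free_downDom, free_levelHarris, fun j hj => ⟨free_gDom j hj, free_vDom j hj⟩⟩
  | .pin => ⟨pin_downDom, pin_levelHarris, fun j _ => ⟨pin_gDom j, pin_vDom j⟩⟩
  | .absent => ⟨absent_downDom, absent_levelHarris, fun j _ => ⟨absent_gDom j, absent_vDom j⟩⟩
  | .ser s t =>
      have hs := SP.graded s
      have ht := SP.graded t
      ⟨downDom_ser s.rLab s.bLab t.rLab t.bLab hs.1 (capHarris_of_levelHarris _ _ hs.2.1) ht.1
          (capHarris_of_levelHarris _ _ ht.2.1),
       levelHarris_ser s.rLab s.bLab t.rLab t.bLab hs.2.1 ht.2.1,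
       fun j hj =>
        ⟨gDom_ser j hj s.rLab s.bLab t.rLab t.bLab (hs.2.2 j hj).1 (hs.2.2 j hj).2 (ht.2.2 j hj).1 (ht.2.2 j hj).2,
         vDom_ser j hj s.rLab s.bLab t.rLab t.bLab (hs.2.2 j hj).2 (ht.2.2 j hj).2⟩⟩
  | .par s t =>
      have hs := SP.graded s
      have ht := SP.graded t
      ⟨downDom_par s.rLab s.bLab t.rLab t.bLab hs.1 ht.1,
       levelHarris_par s.rLab s.bLab t.rLab t.bLab hs.2.1 ht.2.1,
       fun j hj =>
        ⟨gDom_par_le j s.rLab s.bLab t.rLab t.bLab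
            (gDom_le_of _ _ hs.1 (fun i hi => (hs.2.2 i hi).1) j)
            (gDom_le_of _ _ ht.1 (fun i hi => (ht.2.2 i hi).1) j),
         by
          rcases Nat.lt_or_ge j 3 with h3 | h3
          · have hj2 : j = 2 := by omega
            subst hj2
            exact vDom_par2 s.rLab s.bLab t.rLab t.bLab (hs.2.2 2 le_rfl).2 hs.2.1 (ht.2.2 2 le_rfl).2 ht.2.1
          · exact vDom_par j h3 s.rLab s.bLab t.rLab t.bLab
              (fun i hi _ => (hs.2.2 i hi).2) hs.2.1 (fun i hi _ => (ht.2.2 i hi).2) ht.2.1⟩⟩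

/-- **`G_k` on every series–parallel network, at every level**: every lower set `D` of the configuration
poset has `#(D ∩ {r = 1, b ≥ k−1}) ≥ Σ_{D ∩ {r = 0, b ≥ k}} b`. -/
theorem SP.gDom (k : ℕ) (s : SP) : GDom k s.rLab s.bLab := by
  rcases Nat.lt_or_ge k 2 with h | h
  · exact gDom_of_downDom k (by omega) _ _ (SP.graded s).1
  · exact ((SP.graded s).2.2 k h).1

/-- **`V2_k` on every series–parallel network, at every level `k ≥ 2`**: every lower set `D` has
`#(D ∩ {b = k−1, r ≥ 1}) ≥ Σ_{D ∩ {r = 0, b ≥ k}} b`. -/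
theorem SP.vDom (k : ℕ) (hk : 2 ≤ k) (s : SP) : VDom k s.rLab s.bLab := ((SP.graded s).2.2 k hk).2

/-- the count of `G_k` on a series–parallel network: `#{r = 1, b ≥ k−1} ≥ Σ_{r = 0, b ≥ k} b` (the row
(U_k)). -/
theorem SP.sum_gw_nonneg (k : ℕ) (s : SP) : 0 ≤ ∑ c, gw k (s.rLab c) (s.bLab c) :=
  SP.gDom k s univ (by simp [isLowerSet_univ])

/-- the count of `V2_k` on a series–parallel network: `#{b = k−1, r ≥ 1} ≥ Σ_{r = 0, b ≥ k} b`. -/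
theorem SP.sum_vw_nonneg (k : ℕ) (hk : 2 ≤ k) (s : SP) : 0 ≤ ∑ c, vw k (s.rLab c) (s.bLab c) :=
  SP.vDom k hk s univ (by simp [isLowerSet_univ])

end Summit.Ventures.PercRepro2.V2Closure
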